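import Literature.Barriers.NavierStokesRegularity.NavierStokesInequalityCantorOscillatoryProcesses
import Literature.Barriers.NavierStokesRegularity.NavierStokesInequalityProfileConvergence
import HarnessLib

/-!
# Uniform convergence with derivatives of the oscillatory integrals of (6.20) (Ożański 2017, §6.3–§6.4)

Barrier catalogue support file for `NavierStokesRegularity` (D-0021), on the discharge path of
fact D′ `Literature.Barriers.NavierStokesRegularity.NSICantorBlock_of_arrangement`
(`NavierStokesInequalityCantorArrangement`; W. S. Ożański, arXiv:1709.00602v4, §6.3 Step 2 and
§6.4; V. Scheffer, Comm. Math. Phys. 110 (1987), Lemmas 3.1–3.2). It is the `𝔐`-pair version of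
the tree's `NavierStokesInequalityProfileConvergence` (the one-point (4.16)/(4.18)/(4.22)): by
(6.20), for the pair `𝔪` and `i ∈ {1,2}`,

  `(q^{𝔪,k}_{i,t})² - (h^𝔪_{i,t})² = -(∫₀ᵗ a_i^{𝔪,k}(s)(G_i^𝔪(x,s) + Σ_{l,𝔫} F_{i,l}^{𝔪,𝔫}(x,s,a_l^{𝔫,k}(s))) ds - limit)`,

where, by the affine dependence of `∇p[bv,f]` on `b²`, `F_{i,l}^{𝔪,𝔫}(x,s,b) = b² f_{i,l}^{𝔪,𝔫}(s,x)`
is an explicit even polynomial in `b` and the `b`-independent part joins `G_i^𝔪`. Theorem 17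
(the tree's `exists_cantorOscillatoryProcesses`, PROVED) gives the uniform convergence (6.27) —
to `½∫₀ᵗ(F_{2,1}^{𝔪,𝔪}(x,s,1) - F_{2,1}^{𝔪,𝔪}(x,s,0)) ds` for `i = 2` and to `0` for `i = 1` —
uniformly in `(x,t) ∈ P × [0,T]` and in `𝔪`; and since `x`-derivatives pass under the time
integral and preserve the shape `b² f`, the same theorem applied to the differentiated families
gives the convergence (6.21) of the derivatives ("for each multiindex `α`, `D^α q^{𝔪,k}_{i,t} →
D^α h^𝔪_{i,t}` uniformly", obtained in §6.4 "by taking `G := D^α(…)`, `F := D^α(…)`"). PROVED here: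

* `coscIntegral a g f k i m t x = ∫₀ᵗ a_i^{m,k}(s)(g_i^m(s,x) + Σ_l Σ_n a_l^{n,k}(s)² f_{i,l}^{m,n}(s,x)) ds`,
  `coscLimit f i m t x` (`= ½∫₀ᵗ f_{2,1}^{m,m}(s,x) ds` for `i = 2`, `0` for `i = 1`) and
  `coscError = coscIntegral - coscLimit`, for a finite type `A` of pair indices;
* `IsCantorOscFamily T A a` — smooth processes `a_i^{m,k} ∈ C^∞(ℝ;[-1,1])` with the conclusion of
  Theorem 17 on the plane; `exists_isCantorOscFamily` (from `exists_cantorOscillatoryProcesses`,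
  transported along `A ≃ Fin (card A)`);
* `IsCantorOscFamily.coscError_small` — for continuous families and a compact parameter set,
  `coscError → 0` uniformly on `P × [0,T]`, uniformly in `(i, m)` ((6.27));
* `derivR_coscError`, `derivZ_coscError` and `IsCantorOscFamily.coscError_small_two` —
  `coscError` and all its planar `x`-derivatives of order `≤ 2` are `≤ ε` for `k ≥ K(ε)` ((6.21)
  up to order two, which is what (6.25) consumes through the first lemma of Appendix A.3).

## References

* W. S. Ożański, *On weak solutions to the Navier–Stokes inequality with internal
  singularities*, arXiv:1709.00602v4, §6.3 ((6.20)–(6.21)), §6.4 (Theorem 17, (6.27)–(6.29)).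
  [`Ozanski2017NSISingular`]
* V. Scheffer, *Nearly one dimensional singularities of solutions to the Navier–Stokes
  inequality*, Comm. Math. Phys. 110 (1987), Lemma 3.1 ((3.1)–(3.13)), Lemma 3.2.
  [`Scheffer1987`]
-/

noncomputable section

open Set Function Filter Topology Metric MeasureTheory intervalIntegral
open scoped ContDiff

namespace Literature.Barriers.NavierStokesRegularity

-- nested operator types `ℝ² →L[ℝ] ℝ² →L[ℝ] ℝ` (second derivatives)
set_option maxSynthPendingDepth 3

variable {A : Type*} [Fintype A]

/-! ### The oscillatory integrals of (6.20) in expanded form -/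

/-- **The oscillatory integral of (6.20), expanded in the direction factors**:
`∫₀ᵗ a_i^{m,k}(s) (g_i^m(s,x) + Σ_l Σ_n a_l^{n,k}(s)² f_{i,l}^{m,n}(s,x)) ds`
(`= ∫₀ᵗ a_i^{𝔪,k}(G_i^𝔪 + Σ_{l,𝔫} F_{i,l}^{𝔪,𝔫}(a_l^{𝔫,k})) ds` with `F(x,s,b) = b² f(s,x)`).
Indices `i ∈ Fin 2` (`0 ↦ 1`, `1 ↦ 2`), pairs `m : A`. [cite: Ozanski2017NSISingular, §6.3 (6.20) and §6.4 (6.27)] -/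
def coscIntegral (a : ℕ → Fin 2 → A → ℝ → ℝ) (g : Fin 2 → A → ℝ → ℝ × ℝ → ℝ)
    (f : Fin 2 → Fin 2 → A → A → ℝ → ℝ × ℝ → ℝ) (k : ℕ) (i : Fin 2) (m : A) (t : ℝ)
    (x : ℝ × ℝ) : ℝ :=
  ∫ s in (0 : ℝ)..t, a k i m s * (g i m s x + ∑ l, ∑ n, a k l n s ^ 2 * f i l m n s x)

/-- **The limit (6.27)**: `½∫₀ᵗ (F_{2,1}^{m,m}(x,s,1) - F_{2,1}^{m,m}(x,s,0)) ds = ½∫₀ᵗ f_{2,1}^{m,m}(s,x) ds`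
for `i = 2`, and `0` for `i = 1`. [cite: Ozanski2017NSISingular, §6.4 (6.27)] -/
def coscLimit (f : Fin 2 → Fin 2 → A → A → ℝ → ℝ × ℝ → ℝ) (i : Fin 2) (m : A) (t : ℝ)
    (x : ℝ × ℝ) : ℝ :=
  if i = 1 then 1 / 2 * ∫ s in (0 : ℝ)..t, f 1 0 m m s x else 0

/-- The error `coscIntegral - coscLimit` (what (6.27) makes small).
[cite: Ozanski2017NSISingular, §6.4 (6.27)] -/
def coscError (a : ℕ → Fin 2 → A → ℝ → ℝ) (g : Fin 2 → A → ℝ → ℝ × ℝ → ℝ)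
    (f : Fin 2 → Fin 2 → A → A → ℝ → ℝ × ℝ → ℝ) (k : ℕ) (i : Fin 2) (m : A) (t : ℝ)
    (x : ℝ × ℝ) : ℝ :=
  coscIntegral a g f k i m t x - coscLimit f i m t x

variable (A) in
/-- **The new oscillatory processes on the plane**: smooth `a_i^{m,k} ∈ C^∞(ℝ;[-1,1])` such that
for every set `P ⊆ ℝ²` and all bounded, uniformly continuous `G_i^m`, `F_{i,l}^{m,n}` (on
`P × [0,T]`, `P × [0,T] × [-1,1]`) with `F_{i,l}^{m,n}(x,s,-1) = F_{i,l}^{m,n}(x,s,1)`, the integrals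
`∫₀ᵗ a_i^{m,k}(G_i^m + Σ_{l,n} F_{i,l}^{m,n}(a_l^{n,k})) ds` converge uniformly on `P × [0,T]` and
in `m` to `½∫₀ᵗ(F_{2,1}^{m,m}(·,·,1) - F_{2,1}^{m,m}(·,·,0))` (`i = 2`) and `0` (`i = 1`) — the
conclusion of Theorem 17. [cite: Ozanski2017NSISingular, §6.4 Theorem 17] -/
def IsCantorOscFamily (T : ℝ) (a : ℕ → Fin 2 → A → ℝ → ℝ) : Prop :=
  (∀ k i m, ContDiff ℝ ∞ (a k i m)) ∧ (∀ k i m s, a k i m s ∈ Icc (-1 : ℝ) 1) ∧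
    ∀ (P : Set (ℝ × ℝ)) (G : Fin 2 → A → ℝ × ℝ → ℝ → ℝ)
      (F : Fin 2 → Fin 2 → A → A → ℝ × ℝ → ℝ → ℝ → ℝ),
      (∃ N, (∀ i m, ∀ x ∈ P, ∀ s ∈ Icc 0 T, |G i m x s| ≤ N) ∧
        ∀ i l m n, ∀ x ∈ P, ∀ s ∈ Icc 0 T, ∀ b ∈ Icc (-1 : ℝ) 1, |F i l m n x s b| ≤ N) →
      (∀ i m, UniformContinuousOn (fun p : (ℝ × ℝ) × ℝ => G i m p.1 p.2) (P ×ˢ Icc 0 T)) →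
      (∀ i l m n, UniformContinuousOn (fun p : (ℝ × ℝ) × ℝ × ℝ => F i l m n p.1 p.2.1 p.2.2)
        (P ×ˢ Icc 0 T ×ˢ Icc (-1) 1)) →
      (∀ i l m n, ∀ x ∈ P, ∀ s ∈ Icc 0 T, F i l m n x s (-1) = F i l m n x s 1) →
      ∀ ε > 0, ∃ K : ℕ, ∀ k ≥ K, ∀ m, ∀ x ∈ P, ∀ t ∈ Icc 0 T,
        |(∫ s in (0 : ℝ)..t, a k 1 m s *
            (G 1 m x s + ∑ l, ∑ n, F 1 l m n x s (a k l n s))) -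
            1 / 2 * ∫ s in (0 : ℝ)..t, (F 1 0 m m x s 1 - F 1 0 m m x s 0)| ≤ ε ∧
        |∫ s in (0 : ℝ)..t, a k 0 m s *
            (G 0 m x s + ∑ l, ∑ n, F 0 l m n x s (a k l n s))| ≤ ε

variable (A) in
/-- **Theorem 17 (Ożański 2017): the new oscillatory processes exist** for any finite type of
pair indices (the tree's `exists_cantorOscillatoryProcesses` for `𝔐 = card A` pairs, transported
along `A ≃ Fin (card A)`). [cite: Ozanski2017NSISingular, §6.4 Theorem 17] -/
theorem exists_isCantorOscFamily {T : ℝ} (hT : 0 < T) :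
    ∃ a : ℕ → Fin 2 → A → ℝ → ℝ, IsCantorOscFamily A T a := by
  obtain ⟨a₀, ha₀, ha₁, hspec⟩ := Scheffer.exists_cantorOscillatoryProcesses hT (Fintype.card A)
  set e : A ≃ Fin (Fintype.card A) := Fintype.equivFin A
  refine ⟨fun k i m => a₀ k i (e m), fun k i m => ha₀ k i (e m), fun k i m s => ha₁ k i (e m) s, ?_⟩
  intro P G F hb hG hF hsymm ε hε
  -- transport the data to `Fin (card A)`
  set G' : Fin 2 → Fin (Fintype.card A) → ℝ × ℝ → ℝ → ℝ := fun i 𝔪 => G i (e.symm 𝔪) with hG'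
  set F' : Fin 2 → Fin 2 → Fin (Fintype.card A) → Fin (Fintype.card A) → ℝ × ℝ → ℝ → ℝ → ℝ :=
    fun i l 𝔪 𝔫 => F i l (e.symm 𝔪) (e.symm 𝔫) with hF'
  obtain ⟨N, hGN, hFN⟩ := hb
  have hb' : ∃ N, (∀ i 𝔪, ∀ x ∈ P, ∀ s ∈ Icc 0 T, |G' i 𝔪 x s| ≤ N) ∧
      ∀ i l 𝔪 𝔫, ∀ x ∈ P, ∀ s ∈ Icc 0 T, ∀ b ∈ Icc (-1 : ℝ) 1, |F' i l 𝔪 𝔫 x s b| ≤ N :=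
    ⟨N, fun i 𝔪 => hGN i _, fun i l 𝔪 𝔫 => hFN i l _ _⟩
  obtain ⟨K, hK⟩ := hspec P G' F' hb' (fun i 𝔪 => hG i _) (fun i l 𝔪 𝔫 => hF i l _ _)
    (fun i l 𝔪 𝔫 => hsymm i l _ _) ε hε
  refine ⟨K, fun k hk m x hx t ht => ?_⟩
  obtain ⟨h1, h0⟩ := hK k hk (e m) x hx t ht
  have hsum : ∀ (i : Fin 2) (s : ℝ),
      ∑ l, ∑ 𝔫, F' i l (e m) 𝔫 x s (a₀ k l 𝔫 s) = ∑ l, ∑ n, F i l m n x s (a₀ k l (e n) s) := by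
    intro i s
    refine Finset.sum_congr rfl fun l _ => ?_
    rw [← e.sum_comp]
    simp [hF']
  simp only [hG', hF', Equiv.symm_apply_apply] at h1 h0 hsum
  simp only [hsum] at h1 h0
  exact ⟨h1, h0⟩

namespace IsCantorOscFamily

variable {T : ℝ} {a : ℕ → Fin 2 → A → ℝ → ℝ}

/-- The processes are smooth. [cite: Ozanski2017NSISingular, §6.4 Theorem 17] -/
theorem contDiff (ha : IsCantorOscFamily A T a) (k : ℕ) (i : Fin 2) (m : A) :
    ContDiff ℝ ∞ (a k i m) :=
  ha.1 k i m

/-- `|a_i^{m,k}| ≤ 1`. [cite: Ozanski2017NSISingular, §6.4 Theorem 17] -/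
theorem abs_le (ha : IsCantorOscFamily A T a) (k : ℕ) (i : Fin 2) (m : A) (s : ℝ) :
    |a k i m s| ≤ 1 :=
  _root_.abs_le.2 (ha.2.1 k i m s)

/-- `a_i^{m,k}(s)² ≤ 1`. [folklore] -/
theorem sq_le (ha : IsCantorOscFamily A T a) (k : ℕ) (i : Fin 2) (m : A) (s : ℝ) :
    a k i m s ^ 2 ≤ 1 := by
  have h := ha.2.1 k i m s
  nlinarith [h.1, h.2]

/-- **(6.27) for continuous families on a compact parameter set**: if `g_i^m`, `f_{i,l}^{m,n}` are
jointly continuous in `(s,x)` and `P` is compact, then for every `ε > 0` there is `K` with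
`|coscError a g f k i m t x| ≤ ε` for all `k ≥ K`, `x ∈ P`, `t ∈ [0,T]`, `i`, `m` (boundedness
and uniform continuity on the compact `P × [0,T] × [-1,1]` being automatic, and `b² f` even in
`b`). [cite: Ozanski2017NSISingular, §6.4 (6.27) and Theorem 17] -/
theorem coscError_small (ha : IsCantorOscFamily A T a) {P : Set (ℝ × ℝ)} (hP : IsCompact P)
    {g : Fin 2 → A → ℝ → ℝ × ℝ → ℝ} {f : Fin 2 → Fin 2 → A → A → ℝ → ℝ × ℝ → ℝ}
    (hg : ∀ i m, Continuous (uncurry (g i m)))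
    (hf : ∀ i l m n, Continuous (uncurry (f i l m n))) :
    ∀ ε > 0, ∃ K : ℕ, ∀ k ≥ K, ∀ x ∈ P, ∀ t ∈ Icc (0 : ℝ) T, ∀ i m,
      |coscError a g f k i m t x| ≤ ε := by
  intro ε hε
  -- the printed data `G(x,s) = g(s,x)`, `F(x,s,b) = b² f(s,x)`
  set G : Fin 2 → A → ℝ × ℝ → ℝ → ℝ := fun i m x s => g i m s x with hG
  set F : Fin 2 → Fin 2 → A → A → ℝ × ℝ → ℝ → ℝ → ℝ :=
    fun i l m n x s b => b ^ 2 * f i l m n s x with hF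
  have hK1 : IsCompact (P ×ˢ Icc (0 : ℝ) T) := hP.prod isCompact_Icc
  have hK2 : IsCompact (P ×ˢ Icc (0 : ℝ) T ×ˢ Icc (-1 : ℝ) 1) :=
    hP.prod (isCompact_Icc.prod isCompact_Icc)
  have hGc : ∀ i m, Continuous fun p : (ℝ × ℝ) × ℝ => G i m p.1 p.2 := fun i m =>
    (hg i m).comp (continuous_snd.prodMk continuous_fst)
  have hFc : ∀ i l m n, Continuous fun p : (ℝ × ℝ) × ℝ × ℝ => F i l m n p.1 p.2.1 p.2.2 :=
    fun i l m n => ((continuous_snd.comp continuous_snd).pow 2).mul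
      ((hf i l m n).comp ((continuous_fst.comp continuous_snd).prodMk continuous_fst))
  -- one bound for all the (finitely many) families: bound the sums of absolute values
  set SG : (ℝ × ℝ) × ℝ → ℝ := fun p => ∑ i, ∑ m, |G i m p.1 p.2| with hSG
  set SF : (ℝ × ℝ) × ℝ × ℝ → ℝ := fun p => ∑ i, ∑ l, ∑ m, ∑ n, |F i l m n p.1 p.2.1 p.2.2|
    with hSF
  have hSGc : Continuous SG :=
    continuous_finsetSum _ fun i _ => continuous_finsetSum _ fun m _ => (hGc i m).abs
  have hSFc : Continuous SF :=
    continuous_finsetSum _ fun i _ => continuous_finsetSum _ fun l _ =>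
      continuous_finsetSum _ fun m _ => continuous_finsetSum _ fun n _ => (hFc i l m n).abs
  obtain ⟨NG, hNG⟩ := hK1.exists_bound_of_continuousOn hSGc.continuousOn
  obtain ⟨NF, hNF⟩ := hK2.exists_bound_of_continuousOn hSFc.continuousOn
  have hGle : ∀ i m (p : (ℝ × ℝ) × ℝ), |G i m p.1 p.2| ≤ SG p := fun i m p => by
    have h1 : |G i m p.1 p.2| ≤ ∑ m', |G i m' p.1 p.2| :=
      Finset.single_le_sum (f := fun m' => |G i m' p.1 p.2|) (fun _ _ => abs_nonneg _)
        (Finset.mem_univ m)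
    exact h1.trans (Finset.single_le_sum (f := fun i' => ∑ m', |G i' m' p.1 p.2|)
      (fun _ _ => Finset.sum_nonneg fun _ _ => abs_nonneg _) (Finset.mem_univ i))
  have hFle : ∀ i l m n (p : (ℝ × ℝ) × ℝ × ℝ), |F i l m n p.1 p.2.1 p.2.2| ≤ SF p := by
    intro i l m n p
    have h1 : |F i l m n p.1 p.2.1 p.2.2| ≤ ∑ n', |F i l m n' p.1 p.2.1 p.2.2| :=
      Finset.single_le_sum (f := fun n' => |F i l m n' p.1 p.2.1 p.2.2|) (fun _ _ => abs_nonneg _)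
        (Finset.mem_univ n)
    have h2 : ∑ n', |F i l m n' p.1 p.2.1 p.2.2| ≤ ∑ m', ∑ n', |F i l m' n' p.1 p.2.1 p.2.2| :=
      Finset.single_le_sum (f := fun m' => ∑ n', |F i l m' n' p.1 p.2.1 p.2.2|)
        (fun _ _ => Finset.sum_nonneg fun _ _ => abs_nonneg _) (Finset.mem_univ m)
    have h3 : ∑ m', ∑ n', |F i l m' n' p.1 p.2.1 p.2.2| ≤
        ∑ l', ∑ m', ∑ n', |F i l' m' n' p.1 p.2.1 p.2.2| :=
      Finset.single_le_sum (f := fun l' => ∑ m', ∑ n', |F i l' m' n' p.1 p.2.1 p.2.2|)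
        (fun _ _ => Finset.sum_nonneg fun _ _ => Finset.sum_nonneg fun _ _ => abs_nonneg _)
        (Finset.mem_univ l)
    have h4 : ∑ l', ∑ m', ∑ n', |F i l' m' n' p.1 p.2.1 p.2.2| ≤ SF p :=
      Finset.single_le_sum (f := fun i' => ∑ l', ∑ m', ∑ n', |F i' l' m' n' p.1 p.2.1 p.2.2|)
        (fun _ _ => Finset.sum_nonneg fun _ _ => Finset.sum_nonneg fun _ _ =>
          Finset.sum_nonneg fun _ _ => abs_nonneg _) (Finset.mem_univ i)
    exact h1.trans (h2.trans (h3.trans h4))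
  set N : ℝ := max NG NF
  have hb : ∃ N, (∀ i m, ∀ x ∈ P, ∀ s ∈ Icc 0 T, |G i m x s| ≤ N) ∧
      ∀ i l m n, ∀ x ∈ P, ∀ s ∈ Icc 0 T, ∀ b ∈ Icc (-1 : ℝ) 1, |F i l m n x s b| ≤ N := by
    refine ⟨N, fun i m x hx s hs => ?_, fun i l m n x hx s hs b hb => ?_⟩
    · have h := hNG (x, s) ⟨hx, hs⟩
      rw [Real.norm_of_nonneg (Finset.sum_nonneg fun _ _ => Finset.sum_nonneg fun _ _ =>
        abs_nonneg _)] at h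
      exact ((hGle i m (x, s)).trans h).trans (le_max_left _ _)
    · have h := hNF (x, s, b) ⟨hx, hs, hb⟩
      rw [Real.norm_of_nonneg (Finset.sum_nonneg fun _ _ => Finset.sum_nonneg fun _ _ =>
        Finset.sum_nonneg fun _ _ => Finset.sum_nonneg fun _ _ => abs_nonneg _)] at h
      exact ((hFle i l m n (x, s, b)).trans h).trans (le_max_right _ _)
  have huG : ∀ i m, UniformContinuousOn (fun p : (ℝ × ℝ) × ℝ => G i m p.1 p.2) (P ×ˢ Icc 0 T) :=
    fun i m => hK1.uniformContinuousOn_of_continuous (hGc i m).continuousOn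
  have huF : ∀ i l m n, UniformContinuousOn (fun p : (ℝ × ℝ) × ℝ × ℝ => F i l m n p.1 p.2.1 p.2.2)
      (P ×ˢ Icc 0 T ×ˢ Icc (-1) 1) :=
    fun i l m n => hK2.uniformContinuousOn_of_continuous (hFc i l m n).continuousOn
  have hsymm : ∀ i l m n, ∀ x ∈ P, ∀ s ∈ Icc (0 : ℝ) T, F i l m n x s (-1) = F i l m n x s 1 := by
    intro i l m n x _ s _; simp [hF]
  obtain ⟨K, hK⟩ := ha.2.2 P G F hb huG huF hsymm ε hε
  refine ⟨K, fun k hk x hx t ht i m => ?_⟩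
  obtain ⟨h1, h0⟩ := hK k hk m x hx t ht
  fin_cases i
  · simpa [coscError, coscIntegral, coscLimit, hG, hF] using h0
  · have e : (fun s => F 1 0 m m x s 1 - F 1 0 m m x s 0) = fun s => f 1 0 m m s x := by
      funext s; simp [hF]
    rw [e] at h1
    simpa [coscError, coscIntegral, coscLimit, hG, hF] using h1

end IsCantorOscFamily

/-! ### Planar derivatives of the oscillatory integrals -/

section Deriv

variable {T : ℝ} {a : ℕ → Fin 2 → A → ℝ → ℝ} {g : Fin 2 → A → ℝ → ℝ × ℝ → ℝ}
  {f : Fin 2 → Fin 2 → A → A → ℝ → ℝ × ℝ → ℝ}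

/-- The differentiated families `∂ᵣg`, in `x`. [folklore] -/
def cdR (g : Fin 2 → A → ℝ → ℝ × ℝ → ℝ) : Fin 2 → A → ℝ → ℝ × ℝ → ℝ :=
  fun i m s x => derivR (g i m s) x

/-- The differentiated families `∂_zg`, in `x`. [folklore] -/
def cdZ (g : Fin 2 → A → ℝ → ℝ × ℝ → ℝ) : Fin 2 → A → ℝ → ℝ × ℝ → ℝ :=
  fun i m s x => derivZ (g i m s) x

/-- `∂ᵣ` on the two-pair families. [folklore] -/
def cdR₂ (f : Fin 2 → Fin 2 → A → A → ℝ → ℝ × ℝ → ℝ) : Fin 2 → Fin 2 → A → A → ℝ → ℝ × ℝ → ℝ :=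
  fun i l m n s x => derivR (f i l m n s) x

/-- `∂_z` on the two-pair families. [folklore] -/
def cdZ₂ (f : Fin 2 → Fin 2 → A → A → ℝ → ℝ × ℝ → ℝ) : Fin 2 → Fin 2 → A → A → ℝ → ℝ × ℝ → ℝ :=
  fun i l m n s x => derivZ (f i l m n s) x

omit [Fintype A] in
/-- `∂ᵣ` of a jointly smooth family is jointly smooth. [folklore] -/
theorem contDiff_cdR (hg : ∀ i m, ContDiff ℝ ∞ (uncurry (g i m))) (i : Fin 2) (m : A) :
    ContDiff ℝ ∞ (uncurry (cdR g i m)) :=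
  (hg i m).derivR_param (P := g i m)

omit [Fintype A] in
/-- `∂_z` of a jointly smooth family is jointly smooth. [folklore] -/
theorem contDiff_cdZ (hg : ∀ i m, ContDiff ℝ ∞ (uncurry (g i m))) (i : Fin 2) (m : A) :
    ContDiff ℝ ∞ (uncurry (cdZ g i m)) :=
  (hg i m).derivZ_param (P := g i m)

omit [Fintype A] in
/-- `∂ᵣ` of a jointly smooth family is jointly smooth. [folklore] -/
theorem contDiff_cdR₂ (hf : ∀ i l m n, ContDiff ℝ ∞ (uncurry (f i l m n))) (i l : Fin 2)
    (m n : A) : ContDiff ℝ ∞ (uncurry (cdR₂ f i l m n)) :=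
  (hf i l m n).derivR_param (P := f i l m n)

omit [Fintype A] in
/-- `∂_z` of a jointly smooth family is jointly smooth. [folklore] -/
theorem contDiff_cdZ₂ (hf : ∀ i l m n, ContDiff ℝ ∞ (uncurry (f i l m n))) (i l : Fin 2)
    (m n : A) : ContDiff ℝ ∞ (uncurry (cdZ₂ f i l m n)) :=
  (hf i l m n).derivZ_param (P := f i l m n)

/-- The integrand of `coscIntegral` is jointly smooth in `(s,x)`. [folklore] -/
theorem contDiff_coscIntegrand (ha : IsCantorOscFamily A T a)
    (hg : ∀ i m, ContDiff ℝ ∞ (uncurry (g i m)))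
    (hf : ∀ i l m n, ContDiff ℝ ∞ (uncurry (f i l m n))) (k : ℕ) (i : Fin 2) (m : A) :
    ContDiff ℝ ∞ (uncurry fun (s : ℝ) (x : ℝ × ℝ) =>
      a k i m s * (g i m s x + ∑ l, ∑ n, a k l n s ^ 2 * f i l m n s x)) := by
  have hA : ∀ j n, ContDiff ℝ ∞ fun p : ℝ × (ℝ × ℝ) => a k j n p.1 := fun j n =>
    (ha.contDiff k j n).comp contDiff_fst
  have hS : ContDiff ℝ ∞ fun p : ℝ × (ℝ × ℝ) => ∑ l, ∑ n, a k l n p.1 ^ 2 * f i l m n p.1 p.2 :=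
    ContDiff.sum fun l _ => ContDiff.sum fun n _ => ((hA l n).pow 2).mul (hf i l m n)
  exact (hA i m).mul ((hg i m).add hS)

/-- The `x`-derivative of the integrand at a fixed time: the direction factors are constants.
[folklore] -/
theorem hasFDerivAt_coscIntegrand (hg : ∀ i m, ContDiff ℝ ∞ (uncurry (g i m)))
    (hf : ∀ i l m n, ContDiff ℝ ∞ (uncurry (f i l m n))) (k : ℕ) (i : Fin 2) (m : A) (s : ℝ)
    (x : ℝ × ℝ) :
    HasFDerivAt (fun x' => a k i m s * (g i m s x' + ∑ l, ∑ n, a k l n s ^ 2 * f i l m n s x'))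
      (a k i m s • (fderiv ℝ (g i m s) x +
        ∑ l, ∑ n, a k l n s ^ 2 • fderiv ℝ (f i l m n s) x)) x := by
  have hgd : DifferentiableAt ℝ (g i m s) x := ((hg i m).slice_param s).differentiable (by simp) x
  have hfd : ∀ l n, DifferentiableAt ℝ (f i l m n s) x := fun l n =>
    ((hf i l m n).slice_param s).differentiable (by simp) x
  have hS : HasFDerivAt (fun x' => ∑ l, ∑ n, a k l n s ^ 2 * f i l m n s x')
      (∑ l, ∑ n, a k l n s ^ 2 • fderiv ℝ (f i l m n s) x) x :=
    HasFDerivAt.fun_sum fun l _ => HasFDerivAt.fun_sum fun n _ => (hfd l n).hasFDerivAt.const_mul _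
  exact (hgd.hasFDerivAt.add hS).const_mul _

/-- **`∂ᵣ` of the oscillatory integral is the oscillatory integral of the `∂ᵣ`-families**
(derivatives pass under the time integral and the direction factors are constants in `x`).
[cite: Ozanski2017NSISingular, §6.3 (6.21)] -/
theorem derivR_coscIntegral (ha : IsCantorOscFamily A T a)
    (hg : ∀ i m, ContDiff ℝ ∞ (uncurry (g i m)))
    (hf : ∀ i l m n, ContDiff ℝ ∞ (uncurry (f i l m n))) (k : ℕ) (i : Fin 2) (m : A) (t : ℝ)
    (x : ℝ × ℝ) :
    derivR (coscIntegral a g f k i m t) x = coscIntegral a (cdR g) (cdR₂ f) k i m t x := by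
  have hΦ := contDiff_coscIntegrand ha hg hf k i m
  rw [show coscIntegral a g f k i m t = fun x' => ∫ s in (0 : ℝ)..t,
      a k i m s * (g i m s x' + ∑ l, ∑ n, a k l n s ^ 2 * f i l m n s x') from rfl,
    derivR_primitive_param hΦ t x, coscIntegral]
  refine intervalIntegral.integral_congr fun s _ => ?_
  simp only [cdR, cdR₂, derivR]
  rw [(hasFDerivAt_coscIntegrand hg hf k i m s x).fderiv]
  simp only [FunLike.coe_smul, Pi.smul_apply, _root_.add_apply,
    _root_.sum_apply, smul_eq_mul]

/-- **`∂_z` of the oscillatory integral is the oscillatory integral of the `∂_z`-families.**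
[cite: Ozanski2017NSISingular, §6.3 (6.21)] -/
theorem derivZ_coscIntegral (ha : IsCantorOscFamily A T a)
    (hg : ∀ i m, ContDiff ℝ ∞ (uncurry (g i m)))
    (hf : ∀ i l m n, ContDiff ℝ ∞ (uncurry (f i l m n))) (k : ℕ) (i : Fin 2) (m : A) (t : ℝ)
    (x : ℝ × ℝ) :
    derivZ (coscIntegral a g f k i m t) x = coscIntegral a (cdZ g) (cdZ₂ f) k i m t x := by
  have hΦ := contDiff_coscIntegrand ha hg hf k i m
  rw [show coscIntegral a g f k i m t = fun x' => ∫ s in (0 : ℝ)..t,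
      a k i m s * (g i m s x' + ∑ l, ∑ n, a k l n s ^ 2 * f i l m n s x') from rfl,
    derivZ_primitive_param hΦ t x, coscIntegral]
  refine intervalIntegral.integral_congr fun s _ => ?_
  simp only [cdZ, cdZ₂, derivZ]
  rw [(hasFDerivAt_coscIntegrand hg hf k i m s x).fderiv]
  simp only [FunLike.coe_smul, Pi.smul_apply, _root_.add_apply,
    _root_.sum_apply, smul_eq_mul]

omit [Fintype A] in
/-- The limit as an explicit function of `x`. [folklore] -/
theorem coscLimit_eq (f : Fin 2 → Fin 2 → A → A → ℝ → ℝ × ℝ → ℝ) (i : Fin 2) (m : A) (t : ℝ) :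
    coscLimit f i m t = if i = 1 then fun x' => 1 / 2 * ∫ s in (0 : ℝ)..t, f 1 0 m m s x'
      else fun _ => 0 := by
  funext x'
  by_cases hi : i = 1 <;> simp [coscLimit, hi]

omit [Fintype A] in
/-- The limit is smooth in `x`. [folklore] -/
theorem contDiff_coscLimit (hf : ∀ i l m n, ContDiff ℝ ∞ (uncurry (f i l m n))) (i : Fin 2)
    (m : A) (t : ℝ) : ContDiff ℝ ∞ (coscLimit f i m t) := by
  rw [coscLimit_eq]
  by_cases hi : i = 1
  · rw [if_pos hi]
    exact contDiff_const.mul ((contDiff_primitive_param (hf 1 0 m m)).comp (contDiff_prodMk_right t))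
  · rw [if_neg hi]
    exact contDiff_const

omit [Fintype A] in
/-- `∂ᵣ` of the limit is the limit of the `∂ᵣ`-family. [cite: Ozanski2017NSISingular, §6.3 (6.21)] -/
theorem derivR_coscLimit (hf : ∀ i l m n, ContDiff ℝ ∞ (uncurry (f i l m n))) (i : Fin 2)
    (m : A) (t : ℝ) (x : ℝ × ℝ) :
    derivR (coscLimit f i m t) x = coscLimit (cdR₂ f) i m t x := by
  by_cases hi : i = 1
  · subst hi
    have hP : ContDiff ℝ ∞ fun x' : ℝ × ℝ => ∫ s in (0 : ℝ)..t, f 1 0 m m s x' :=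
      (contDiff_primitive_param (hf 1 0 m m)).comp (contDiff_prodMk_right t)
    have hd := (hP.differentiable (by simp) x).hasFDerivAt.const_mul (1 / 2 : ℝ)
    rw [show coscLimit f 1 m t = fun x' => 1 / 2 * ∫ s in (0 : ℝ)..t, f 1 0 m m s x' from by
      funext x'; simp [coscLimit], derivR, hd.fderiv]
    simp only [coscLimit, if_true, cdR₂, FunLike.coe_smul, Pi.smul_apply, smul_eq_mul]
    rw [← derivR, derivR_primitive_param (hf 1 0 m m) t x]
  · have e1 : coscLimit f i m t = fun _ => 0 := by funext x'; simp [coscLimit, hi]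
    have e2 : coscLimit (cdR₂ f) i m t x = 0 := by simp [coscLimit, hi]
    rw [e1, e2, derivR]; simp

omit [Fintype A] in
/-- `∂_z` of the limit is the limit of the `∂_z`-family. [cite: Ozanski2017NSISingular, §6.3 (6.21)] -/
theorem derivZ_coscLimit (hf : ∀ i l m n, ContDiff ℝ ∞ (uncurry (f i l m n))) (i : Fin 2)
    (m : A) (t : ℝ) (x : ℝ × ℝ) :
    derivZ (coscLimit f i m t) x = coscLimit (cdZ₂ f) i m t x := by
  by_cases hi : i = 1
  · subst hi
    have hP : ContDiff ℝ ∞ fun x' : ℝ × ℝ => ∫ s in (0 : ℝ)..t, f 1 0 m m s x' :=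
      (contDiff_primitive_param (hf 1 0 m m)).comp (contDiff_prodMk_right t)
    have hd := (hP.differentiable (by simp) x).hasFDerivAt.const_mul (1 / 2 : ℝ)
    rw [show coscLimit f 1 m t = fun x' => 1 / 2 * ∫ s in (0 : ℝ)..t, f 1 0 m m s x' from by
      funext x'; simp [coscLimit], derivZ, hd.fderiv]
    simp only [coscLimit, if_true, cdZ₂, FunLike.coe_smul, Pi.smul_apply, smul_eq_mul]
    rw [← derivZ, derivZ_primitive_param (hf 1 0 m m) t x]
  · have e1 : coscLimit f i m t = fun _ => 0 := by funext x'; simp [coscLimit, hi]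
    have e2 : coscLimit (cdZ₂ f) i m t x = 0 := by simp [coscLimit, hi]
    rw [e1, e2, derivZ]; simp

/-- The oscillatory integral is smooth in `x`. [folklore] -/
theorem contDiff_coscIntegral (ha : IsCantorOscFamily A T a)
    (hg : ∀ i m, ContDiff ℝ ∞ (uncurry (g i m)))
    (hf : ∀ i l m n, ContDiff ℝ ∞ (uncurry (f i l m n))) (k : ℕ) (i : Fin 2) (m : A) (t : ℝ) :
    ContDiff ℝ ∞ (coscIntegral a g f k i m t) :=
  (contDiff_primitive_param (contDiff_coscIntegrand ha hg hf k i m)).comp (contDiff_prodMk_right t)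

/-- **`∂ᵣ(coscError) = coscError` of the `∂ᵣ`-families.** [cite: Ozanski2017NSISingular, §6.3 (6.21)] -/
theorem derivR_coscError (ha : IsCantorOscFamily A T a)
    (hg : ∀ i m, ContDiff ℝ ∞ (uncurry (g i m)))
    (hf : ∀ i l m n, ContDiff ℝ ∞ (uncurry (f i l m n))) (k : ℕ) (i : Fin 2) (m : A) (t : ℝ)
    (x : ℝ × ℝ) :
    derivR (coscError a g f k i m t) x = coscError a (cdR g) (cdR₂ f) k i m t x := by
  have h1 := ((contDiff_coscIntegral ha hg hf k i m t).differentiable (by simp) x).hasFDerivAt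
  have h2 := ((contDiff_coscLimit hf i m t).differentiable (by simp) x).hasFDerivAt
  rw [show coscError a g f k i m t = coscIntegral a g f k i m t - coscLimit f i m t from rfl,
    derivR, (h1.sub h2).fderiv, _root_.sub_apply, ← derivR, ← derivR,
    derivR_coscIntegral ha hg hf, derivR_coscLimit hf, coscError]

/-- **`∂_z(coscError) = coscError` of the `∂_z`-families.** [cite: Ozanski2017NSISingular, §6.3 (6.21)] -/
theorem derivZ_coscError (ha : IsCantorOscFamily A T a)
    (hg : ∀ i m, ContDiff ℝ ∞ (uncurry (g i m)))
    (hf : ∀ i l m n, ContDiff ℝ ∞ (uncurry (f i l m n))) (k : ℕ) (i : Fin 2) (m : A) (t : ℝ)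
    (x : ℝ × ℝ) :
    derivZ (coscError a g f k i m t) x = coscError a (cdZ g) (cdZ₂ f) k i m t x := by
  have h1 := ((contDiff_coscIntegral ha hg hf k i m t).differentiable (by simp) x).hasFDerivAt
  have h2 := ((contDiff_coscLimit hf i m t).differentiable (by simp) x).hasFDerivAt
  rw [show coscError a g f k i m t = coscIntegral a g f k i m t - coscLimit f i m t from rfl,
    derivZ, (h1.sub h2).fderiv, _root_.sub_apply, ← derivZ, ← derivZ,
    derivZ_coscIntegral ha hg hf, derivZ_coscLimit hf, coscError]

/-- Each slice `coscError a g f k i m t` is `C^∞` in `x`. [folklore] -/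
theorem contDiff_coscError (ha : IsCantorOscFamily A T a)
    (hg : ∀ i m, ContDiff ℝ ∞ (uncurry (g i m)))
    (hf : ∀ i l m n, ContDiff ℝ ∞ (uncurry (f i l m n))) (k : ℕ) (i : Fin 2) (m : A) (t : ℝ) :
    ContDiff ℝ ∞ (coscError a g f k i m t) :=
  (contDiff_coscIntegral ha hg hf k i m t).sub (contDiff_coscLimit hf i m t)

/-- `(t,x) ↦ coscError` is jointly `C^∞`. [folklore] -/
theorem contDiff_uncurry_coscError (ha : IsCantorOscFamily A T a)
    (hg : ∀ i m, ContDiff ℝ ∞ (uncurry (g i m)))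
    (hf : ∀ i l m n, ContDiff ℝ ∞ (uncurry (f i l m n))) (k : ℕ) (i : Fin 2) (m : A) :
    ContDiff ℝ ∞ (uncurry (coscError a g f k i m)) := by
  have h1 : ContDiff ℝ ∞ (uncurry (coscIntegral a g f k i m)) :=
    contDiff_primitive_param (contDiff_coscIntegrand ha hg hf k i m)
  have h2 : ContDiff ℝ ∞ (uncurry (coscLimit f i m)) := by
    by_cases hi : i = 1
    · subst hi
      have e : uncurry (coscLimit f 1 m) =
          fun p : ℝ × (ℝ × ℝ) => 1 / 2 * ∫ s in (0 : ℝ)..p.1, f 1 0 m m s p.2 := by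
        funext p
        show coscLimit f 1 m p.1 p.2 = _
        rw [coscLimit, if_pos rfl]
      rw [e]
      exact contDiff_const.mul (contDiff_primitive_param (hf 1 0 m m))
    · have e : uncurry (coscLimit f i m) = fun _ : ℝ × (ℝ × ℝ) => (0 : ℝ) := by
        funext p
        show coscLimit f i m p.1 p.2 = 0
        rw [coscLimit, if_neg hi]
      rw [e]
      exact contDiff_const
  exact h1.sub h2

end Deriv

/-! ### (6.21) up to order two -/

namespace IsCantorOscFamily

variable {T : ℝ} {a : ℕ → Fin 2 → A → ℝ → ℝ}

/-- **(6.21), orders `0, 1, 2`: the oscillatory error and all its planar derivatives up to order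
two are uniformly small on `P × [0,T]` for `k` large**, uniformly in `(i, m)`, for jointly smooth
families and a compact parameter set `P` (seven applications of (6.27): to `(g,f)` and to its
`∂ᵣ`, `∂_z`, `∂ᵣ∂ᵣ`, `∂ᵣ∂_z`, `∂_z∂ᵣ`, `∂_z∂_z` transforms — Ożański §6.4: "by taking
`G := D^α(…)`, `F := D^α(…)` for any given multiindex `α`").
[cite: Ozanski2017NSISingular, §6.3 (6.21) and §6.4 (6.27)] -/
theorem coscError_small_two (ha : IsCantorOscFamily A T a) {P : Set (ℝ × ℝ)} (hP : IsCompact P)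
    {g : Fin 2 → A → ℝ → ℝ × ℝ → ℝ} {f : Fin 2 → Fin 2 → A → A → ℝ → ℝ × ℝ → ℝ}
    (hg : ∀ i m, ContDiff ℝ ∞ (uncurry (g i m)))
    (hf : ∀ i l m n, ContDiff ℝ ∞ (uncurry (f i l m n))) :
    ∀ ε > 0, ∃ K : ℕ, ∀ k ≥ K, ∀ x ∈ P, ∀ t ∈ Icc (0 : ℝ) T, ∀ i m,
      |coscError a g f k i m t x| ≤ ε ∧
      |derivR (coscError a g f k i m t) x| ≤ ε ∧ |derivZ (coscError a g f k i m t) x| ≤ ε ∧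
      |derivR (derivR (coscError a g f k i m t)) x| ≤ ε ∧
      |derivR (derivZ (coscError a g f k i m t)) x| ≤ ε ∧
      |derivZ (derivR (coscError a g f k i m t)) x| ≤ ε ∧
      |derivZ (derivZ (coscError a g f k i m t)) x| ≤ ε := by
  intro ε hε
  -- smoothness of the transformed families
  have hgR := contDiff_cdR hg
  have hgZ := contDiff_cdZ hg
  have hfR := contDiff_cdR₂ hf
  have hfZ := contDiff_cdZ₂ hf
  have hgRR := contDiff_cdR hgR
  have hgRZ := contDiff_cdZ hgR
  have hgZR := contDiff_cdR hgZ
  have hgZZ := contDiff_cdZ hgZ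
  have hfRR := contDiff_cdR₂ hfR
  have hfRZ := contDiff_cdZ₂ hfR
  have hfZR := contDiff_cdR₂ hfZ
  have hfZZ := contDiff_cdZ₂ hfZ
  -- seven thresholds
  have c := fun {g' : Fin 2 → A → ℝ → ℝ × ℝ → ℝ} {f' : Fin 2 → Fin 2 → A → A → ℝ → ℝ × ℝ → ℝ}
      (hg' : ∀ i m, ContDiff ℝ ∞ (uncurry (g' i m)))
      (hf' : ∀ i l m n, ContDiff ℝ ∞ (uncurry (f' i l m n))) =>
    ha.coscError_small hP (fun i m => (hg' i m).continuous) (fun i l m n => (hf' i l m n).continuous)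
      ε hε
  obtain ⟨K₀, hK₀⟩ := c hg hf
  obtain ⟨K₁, hK₁⟩ := c hgR hfR
  obtain ⟨K₂, hK₂⟩ := c hgZ hfZ
  obtain ⟨K₃, hK₃⟩ := c hgRR hfRR
  obtain ⟨K₄, hK₄⟩ := c hgRZ hfRZ
  obtain ⟨K₅, hK₅⟩ := c hgZR hfZR
  obtain ⟨K₆, hK₆⟩ := c hgZZ hfZZ
  refine ⟨max (max (max K₀ K₁) (max K₂ K₃)) (max (max K₄ K₅) K₆), fun k hk x hx t ht i m => ?_⟩
  have hk₀ : K₀ ≤ k := le_trans (by simp) hk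
  have hk₁ : K₁ ≤ k := le_trans (by simp) hk
  have hk₂ : K₂ ≤ k := le_trans (by simp) hk
  have hk₃ : K₃ ≤ k := le_trans (by simp) hk
  have hk₄ : K₄ ≤ k := le_trans (by simp) hk
  have hk₅ : K₅ ≤ k := le_trans (by simp) hk
  have hk₆ : K₆ ≤ k := le_trans (by simp) hk
  -- identify the derivatives of the error with errors of transformed families
  have eR : derivR (coscError a g f k i m t) = coscError a (cdR g) (cdR₂ f) k i m t :=
    funext fun x => derivR_coscError ha hg hf k i m t x
  have eZ : derivZ (coscError a g f k i m t) = coscError a (cdZ g) (cdZ₂ f) k i m t :=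
    funext fun x => derivZ_coscError ha hg hf k i m t x
  refine ⟨hK₀ k hk₀ x hx t ht i m, ?_, ?_, ?_, ?_, ?_, ?_⟩
  · rw [eR]; exact hK₁ k hk₁ x hx t ht i m
  · rw [eZ]; exact hK₂ k hk₂ x hx t ht i m
  · rw [eR, derivR_coscError ha hgR hfR]; exact hK₃ k hk₃ x hx t ht i m
  · rw [eZ, derivR_coscError ha hgZ hfZ]; exact hK₅ k hk₅ x hx t ht i m
  · rw [eR, derivZ_coscError ha hgR hfR]; exact hK₄ k hk₄ x hx t ht i m
  · rw [eZ, derivZ_coscError ha hgZ hfZ]; exact hK₆ k hk₆ x hx t ht i m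

end IsCantorOscFamily

end Literature.Barriers.NavierStokesRegularity
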